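import Literature.Probability.Percolation.SlabRSWProp39b
import Literature.Probability.Percolation.SlabRSWLemma311
import HarnessLib

/-!
# Newman–Tassion–Wu 2017, Proposition 3.9 (2) in the HIGH-PROBABILITY regime (`ε-δ` form) and (3.53)

Topic: `Literature/Probability/Percolation`. Item (2) of NTW's Prop. 3.9 (`f_p(n,n+κn) ≥ h₂^{j-1}(f_p(n,n+jκn))`,
p2's `prop39_item2_step'`: `1 - (1 - f_p(n, n+m+m'))^{1/3} ≤ f_p(n, n+m)` for `0 ≤ m' ≤ m`) in the form used at the
start of the proof of Theorem 3.17 ((3.53): "Assume that `sup_n f(n,2n) = 1`; then by Proposition 3.9,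
`sup_n f(3n,4n) = 1`"): for every `η > 0` there is `δ > 0` (free of `k`, `p`, `n`) such that
`f_p(n, n+m+m') ≥ 1-δ ⟹ f_p(n, n+m) ≥ 1-η`, and `f_p(3n, 6n) ≥ 1-δ ⟹ f_p(3n, 4n) ≥ 1-η`.

* `crossingProb_height_reduce_highProb`, `crossingProb_three_four_highProb` ((3.53)).

## Sources

* C. M. Newman, V. Tassion, W. Wu, *Critical percolation and the minimal spanning tree in slabs*,
  Comm. Pure Appl. Math. 70 (2017), arXiv:1512.09107: Proposition 3.9 (2); §3.6, proof of Theorem 3.17,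
  (3.53) [NewmanTassionWu2017].
-/

noncomputable section

namespace Literature.Probability.Percolation

open MeasureTheory LatticeModels SimpleGraph

namespace NTW17

variable {k : ℕ}

/-- **Prop. 3.9 (2), one step, `ε-δ` form**: for `η > 0` there is `δ > 0` such that for all `k`, `p`,
`n`, `0 ≤ m' ≤ m`: `f_p(n, n+m+m') ≥ 1 - δ ⟹ f_p(n, n+m) ≥ 1 - η` (`δ = min(η,1)³`).
[cite: NewmanTassionWu2017, Proposition 3.9 (2)] -/
theorem crossingProb_height_reduce_highProb {η : ℝ} (hη : 0 < η) :
    ∃ δ : ℝ, 0 < δ ∧ ∀ (k : ℕ) (p : unitInterval) (n m m' : ℕ), m' ≤ m →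
      1 - δ ≤ crossingProb k p n (n + m + m') → 1 - η ≤ crossingProb k p n (n + m) := by
  set η₁ : ℝ := min η 1 with hη₁
  have hη₁0 : 0 < η₁ := lt_min hη one_pos
  have hη₁1 : η₁ ≤ 1 := min_le_right _ _
  have hη₁η : η₁ ≤ η := min_le_left _ _
  refine ⟨η₁ ^ 3, by positivity, fun k p n m m' hmm hf => ?_⟩
  have h := prop39_item2_step' (k := k) (n := n) (m := m) (m' := m') (by positivity) (by exact_mod_cast hmm)
    (by positivity) p
  rw [crossingProb_eq] at hf
  rw [crossingProb_eq]
  push_cast at hf h ⊢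
  set f₂ := (bondPercolation (slabGraph 3 k) p).real
    (slabConn k (boxR 0 (n : ℤ) 0 ((n : ℤ) + m + m')) {z | z.1 = 0} {z | z.1 = (n : ℤ)}) with hf₂
  have hf₂1 : f₂ ≤ 1 := measureReal_le_one
  have h1 : (1 - f₂) ^ ((3 : ℝ)⁻¹) ≤ (η₁ ^ 3) ^ ((3 : ℝ)⁻¹) :=
    Real.rpow_le_rpow (by linarith) (by linarith) (by norm_num)
  have h2 : (η₁ ^ 3) ^ ((3 : ℝ)⁻¹) = η₁ := Real.pow_rpow_inv_natCast hη₁0.le (by norm_num)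
  rw [h2] at h1
  linarith

/-- **(3.53) of the proof of Theorem 3.17, `ε-δ` form**: for `η > 0` there is `δ > 0` such that
`f_p(3n, 6n) ≥ 1 - δ ⟹ f_p(3n, 4n) ≥ 1 - η` (two height reductions `6n → 5n → 4n`).
[cite: NewmanTassionWu2017, §3.6 (proof of Theorem 3.17, (3.53)) with Proposition 3.9 (2)] -/
theorem crossingProb_three_four_highProb {η : ℝ} (hη : 0 < η) :
    ∃ δ : ℝ, 0 < δ ∧ ∀ (k : ℕ) (p : unitInterval) (n : ℕ),
      1 - δ ≤ crossingProb k p (3 * n) (6 * n) → 1 - η ≤ crossingProb k p (3 * n) (4 * n) := by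
  obtain ⟨δ₁, hδ₁, H₁⟩ := crossingProb_height_reduce_highProb hη
  obtain ⟨δ₂, hδ₂, H₂⟩ := crossingProb_height_reduce_highProb hδ₁
  refine ⟨δ₂, hδ₂, fun k p n hf => ?_⟩
  have h5 : 1 - δ₁ ≤ crossingProb k p (3 * n) (3 * n + 2 * n) := by
    refine H₂ k p (3 * n) (2 * n) n (by omega) ?_
    rwa [show 3 * n + 2 * n + n = 6 * n by ring]
  have h4 := H₁ k p (3 * n) n n le_rfl (by rwa [show 3 * n + n + n = 3 * n + 2 * n by ring])
  rwa [show 3 * n + n = 4 * n by ring] at h4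

end NTW17

end Literature.Probability.Percolation

end
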